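import Literature.NumberTheory.Rogawski1990.ArchLimitFormulaNoncompactWallPinTransport   -- ★ FILE 2b p842975 `centralizer_measure_links_of_clause_neg_one` (brings FILE 2a p842692 `exists_centralizer_measure_clause_neg_one`)
import Literature.NumberTheory.Automorphic.ArchLocalWallCentralizerHaar             -- ★ A-p18 `exists_isHaarMeasure_isInvInvariant_centralizer_circleDiagonal_wall` (the base measures)
import HarnessLib

/-!
# THE `(−1)`-PINNED REFERENCE CENTRALISER FAMILY EXISTS at every complex place and every relabelling, with its (T02)(T01) links («(W1-ref)» of the (ST-∞) witness road;
# Rogawski 1990 §8.2 pp. 119, 122–124; Varadarajan 1989 §6.4 Thm 22; Deitmar–Echterhoff Thm. 1.5.3)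

Topic `NumberTheory/Rogawski1990`; namespace `Literature.NumberTheory.Rogawski1990`.  THEOREMS ONLY (no `def`, no instance, no notation, no axiom, no named fact, no `sorry`).
Cell `pub/hodgecm-mathlib`, ENGINE T1 (crux H413 = `stmt-HodgeConjecture-24833`); the (ST-∞) witness road, brick (W1-ref) (F0P3a-p07 (g9); LEAD F0P3a-plan (g10) lane T9-8 (G)); feeds
F0P3-p03 (g10)'s one-stop ★-to-be `exists_pins_conj_coherent_telescope_all` (`νH hνH hT02 hT01`) and ★ p843392's `νH hνH … c hcl hcneg` (with `c := fun _ _ => −1`).  Count-neutral plumbing;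
HONEST LABEL: HC_CM is proved only modulo the printed citations until rung 0 closes; nothing here bears on a summit statement.

WHAT.  **`exists_pinned_reference_centralizer_family`**: on the diagonal carrier `U(diag α)` (`α_i ≠ 0`, `σ_w α_i` real at every complex place), for a reference wall `(z₁ w)` (`(z₁ w)_w 0 = (z₁ w)_w 2 ≠
(z₁ w)_w 1`) and per-place Haar measures `ν_w` on the `G_w(α)`, THERE IS a family `νH w τ` of centraliser measures on the `Z_{G_w(α∘τ)}(diag (z₁ w)_w)` which is (i) Haar and inversion-invariant
everywhere (base measures ★ `exists_isHaarMeasure_isInvInvariant_centralizer_circleDiagonal_wall`), (ii) PINNED at every noncompact relabelling `τ`: the (J-nc) clause of the letter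
★ `ArchLimitFormulaNoncompactWall` holds with constant EXACTLY `−1` for the group measure `(e_τ⁻¹)_* ν_w` (★ p842692 `exists_centralizer_measure_clause_neg_one`) — the `hcl` of ★ (D5) ∕
★ p843392 with `c := −1` — and (iii)(iv) LINK-COHERENT: the (T02)(T01) transport identities of ★ p842445 §3 hold (★ p842975 `centralizer_measure_links_of_clause_neg_one`).

## References
* [Rogawski1990] J. D. Rogawski, *Automorphic Representations of Unitary Groups in Three Variables*, Ann. of Math. Stud. 123 (1990), §8.2 pp. 119, 122–124; §1.7 p. 6.
* [Varadarajan1989] V. S. Varadarajan, *An Introduction to Harmonic Analysis on Semisimple Lie Groups* (1989), §6.4 Thm 22.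
* [DeitmarEchterhoff2014] A. Deitmar, S. Echterhoff, *Principles of Harmonic Analysis*, 2nd ed. (2014), Thm. 1.5.3.
-/

set_option autoImplicit false

noncomputable section

open MeasureTheory Measure Filter Topology NumberField NumberField.InfinitePlace Matrix Equiv
open Literature.MeasureTheory.Group Literature.NumberTheory.Automorphic Literature.NumberTheory.Automorphic.UnitaryGroup
open Literature.LinearAlgebra.Matrix
open scoped Matrix MatrixGroups Matrix.Norms.Operator NNReal ENNReal

namespace Literature.NumberTheory.Rogawski1990

section RefFamily

variable (L : Type) [Field L] [NumberField L] [IsCMField L] (α : Fin 3 → L)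

/-- **THE `(−1)`-PINNED REFERENCE CENTRALISER FAMILY EXISTS, WITH ITS LINKS.**  See the module docstring: (i) Haar ∧ inversion-invariant at every `(w, τ)`; (ii) the (J-nc) clause with
constant `−1` at every noncompact `τ` for the transported group measure `(e_τ⁻¹)_* ν_w`; (iii) (T02) and (iv) (T01) VERBATIM as ★ p842445 §3 ∕ ★ (W3-all) read them.
[cite: Rogawski1990, §8.2 pp. 119, 122–124; §1.7 p. 6] [cite: Varadarajan1989, §6.4 Thm 22] [cite: DeitmarEchterhoff2014, Thm. 1.5.3] -/
theorem exists_pinned_reference_centralizer_family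
    [MeasurableSpace (GL (Fin 3) ℂ)] [BorelSpace (GL (Fin 3) ℂ)]
    (hα : ∀ i, α i ≠ 0) (hreal : ∀ (w : {w : InfinitePlace L // IsComplex w}) (i : Fin 3), (w.1.embedding (α i)).im = 0)
    (z₁ : {w : InfinitePlace L // IsComplex w} → Fin 3 → Circle) (h02 : ∀ w, z₁ w 0 = z₁ w 2) (h01 : ∀ w, z₁ w 0 ≠ z₁ w 1)
    [iR : ∀ (w : {w : InfinitePlace L // IsComplex w}) (τ : Perm (Fin 3)), MeasurableSpace (archLocal L 3 (Matrix.diagonal (α ∘ ⇑τ)) w ⧸ (Subgroup.centralizer ({(⟨circleDiagonal 3 (z₁ w), circleDiagonal_mem_archLocal_diagonal L 3 (α ∘ ⇑τ) w (z₁ w)⟩ : archLocal L 3 (Matrix.diagonal (α ∘ ⇑τ)) w)} : Set (archLocal L 3 (Matrix.diagonal (α ∘ ⇑τ)) w))))]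
    [iRb : ∀ (w : {w : InfinitePlace L // IsComplex w}) (τ : Perm (Fin 3)), BorelSpace (archLocal L 3 (Matrix.diagonal (α ∘ ⇑τ)) w ⧸ (Subgroup.centralizer ({(⟨circleDiagonal 3 (z₁ w), circleDiagonal_mem_archLocal_diagonal L 3 (α ∘ ⇑τ) w (z₁ w)⟩ : archLocal L 3 (Matrix.diagonal (α ∘ ⇑τ)) w)} : Set (archLocal L 3 (Matrix.diagonal (α ∘ ⇑τ)) w))))]
    (νw : ∀ w : {w : InfinitePlace L // IsComplex w}, Measure (archLocal L 3 (Matrix.diagonal α) w)) (hνw : ∀ w, (νw w).IsHaarMeasure ∧ (νw w).IsMulRightInvariant) :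
    ∃ (νH : ∀ (w : {w : InfinitePlace L // IsComplex w}) (τ : Perm (Fin 3)), Measure (Subgroup.centralizer ({(⟨circleDiagonal 3 (z₁ w), circleDiagonal_mem_archLocal_diagonal L 3 (α ∘ ⇑τ) w (z₁ w)⟩ : archLocal L 3 (Matrix.diagonal (α ∘ ⇑τ)) w)} : Set (archLocal L 3 (Matrix.diagonal (α ∘ ⇑τ)) w))))
      (hνH : ∀ w τ, (νH w τ).IsHaarMeasure ∧ (νH w τ).IsInvInvariant),
      (∀ (w : {w : InfinitePlace L // IsComplex w}), ∀ (τ : Perm (Fin 3)), (w.1.embedding (α (τ 0))).re * (w.1.embedding (α (τ 2))).re < 0 →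
      haveI : LocallyCompactSpace (archLocal L 3 (Matrix.diagonal (α ∘ ⇑τ)) w) := locallyCompactSpace_archLocal L 3 (Matrix.diagonal (α ∘ ⇑τ)) w
      haveI : SecondCountableTopology (archLocal L 3 (Matrix.diagonal (α ∘ ⇑τ)) w) := secondCountableTopology_archLocal L 3 (Matrix.diagonal (α ∘ ⇑τ)) w
      haveI : (νH w τ).IsHaarMeasure := (hνH w τ).1
      haveI : (νH w τ).IsInvInvariant := (hνH w τ).2
      haveI : (νw w).IsHaarMeasure := (hνw w).1
      haveI : (νw w).IsMulRightInvariant := (hνw w).2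
      haveI : ((νw w).map (ContinuousMulEquiv.restrictSubgroup (GLn.conjEquiv (Matrix.GeneralLinearGroup.mkOfDetNeZero _ (det_monomial_one_ne_zero 3 τ))) (archLocal L 3 (Matrix.diagonal (α ∘ ⇑τ)) w) (archLocal L 3 (Matrix.diagonal α) w) (mem_archLocal_comp_perm_iff_conj_mem L 3 α w τ)).symm).IsHaarMeasure := ContinuousMulEquiv.isHaarMeasure_map (νw w) _
      haveI : (νw w).IsHaarMeasure := (hνw w).1
      haveI : (νw w).IsMulRightInvariant := (hνw w).2
      haveI : ((νw w).map (ContinuousMulEquiv.restrictSubgroup (GLn.conjEquiv (Matrix.GeneralLinearGroup.mkOfDetNeZero _ (det_monomial_one_ne_zero 3 τ))) (archLocal L 3 (Matrix.diagonal (α ∘ ⇑τ)) w) (archLocal L 3 (Matrix.diagonal α) w) (mem_archLocal_comp_perm_iff_conj_mem L 3 α w τ)).symm).IsMulRightInvariant := isMulRightInvariant_map_relabel_symm L 3 α w τ (νw w)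
      ∀ (Θ : Matrix (Fin 3) (Fin 3) ℂ → ℂ), ContDiff ℝ (⊤ : ℕ∞) Θ →
        HasCompactSupport (fun k : archLocal L 3 (Matrix.diagonal (α ∘ ⇑τ)) w => Θ ((k : GL (Fin 3) ℂ) : Matrix (Fin 3) (Fin 3) ℂ)) →
        ∀ (z₀ : Fin 3 → Circle) (h02' : z₀ 0 = z₀ 2) (h01' : z₀ 0 ≠ z₀ 1),
          Tendsto (fun ψ : ℝ => deriv (fun ψ : ℝ => (2 * Real.sin ψ : ℂ) *
              ∫ g, Θ (((g * ⟨circleDiagonal 3 (fun i => z₀ i * Circle.exp (![(1 : ℝ), 0, -1] i * ψ)),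
                circleDiagonal_mem_archLocal_diagonal L 3 (α ∘ ⇑τ) w _⟩ * g⁻¹ : archLocal L 3 (Matrix.diagonal (α ∘ ⇑τ)) w) : GL (Fin 3) ℂ) : Matrix (Fin 3) (Fin 3) ℂ) ∂((νw w).map (ContinuousMulEquiv.restrictSubgroup (GLn.conjEquiv (Matrix.GeneralLinearGroup.mkOfDetNeZero _ (det_monomial_one_ne_zero 3 τ))) (archLocal L 3 (Matrix.diagonal (α ∘ ⇑τ)) w) (archLocal L 3 (Matrix.diagonal α) w) (mem_archLocal_comp_perm_iff_conj_mem L 3 α w τ)).symm)) ψ)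
            (𝓝[≠] 0)
            (𝓝 ((-1 : ℂ) * ∫ y, descConj (⟨circleDiagonal 3 z₀, circleDiagonal_mem_archLocal_diagonal L 3 (α ∘ ⇑τ) w z₀⟩ : archLocal L 3 (Matrix.diagonal (α ∘ ⇑τ)) w)
              (Subgroup.centralizer ({(⟨circleDiagonal 3 (z₁ w), circleDiagonal_mem_archLocal_diagonal L 3 (α ∘ ⇑τ) w (z₁ w)⟩ : archLocal L 3 (Matrix.diagonal (α ∘ ⇑τ)) w)} : Set (archLocal L 3 (Matrix.diagonal (α ∘ ⇑τ)) w)))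
              (forall_mem_centralizer_circleDiagonal_comm_of_wall L (α ∘ ⇑τ) w (h02 w) (h01 w) h02' h01')
              (fun k : archLocal L 3 (Matrix.diagonal (α ∘ ⇑τ)) w => Θ ((k : GL (Fin 3) ℂ) : Matrix (Fin 3) (Fin 3) ℂ)) y
              ∂(quotientMeasure _ (νH w τ) (isClosed_coe_centralizer_singleton _) ((νw w).map (ContinuousMulEquiv.restrictSubgroup (GLn.conjEquiv (Matrix.GeneralLinearGroup.mkOfDetNeZero _ (det_monomial_one_ne_zero 3 τ))) (archLocal L 3 (Matrix.diagonal (α ∘ ⇑τ)) w) (archLocal L 3 (Matrix.diagonal α) w) (mem_archLocal_comp_perm_iff_conj_mem L 3 α w τ)).symm))))) ∧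
      (∀ (w : {w : InfinitePlace L // IsComplex w}), (∀ (τ : Perm (Fin 3)), (w.1.embedding (α (τ 0))).re * (w.1.embedding (α (τ 2))).re < 0 →
      νH w τ = ((νH w (τ * Equiv.swap (0 : Fin 3) 2)).map (subgroupCongrHomeomorph (ContinuousMulEquiv.restrictSubgroup (GLn.conjEquiv (Matrix.GeneralLinearGroup.mkOfDetNeZero _ (det_monomial_one_ne_zero 3 (Equiv.swap (0 : Fin 3) 2)))) (archLocal L 3 (Matrix.diagonal ((α ∘ ⇑τ) ∘ ⇑(Equiv.swap (0 : Fin 3) 2))) w) (archLocal L 3 (Matrix.diagonal (α ∘ ⇑τ)) w) (mem_archLocal_comp_perm_iff_conj_mem L 3 (α ∘ ⇑τ) w (Equiv.swap (0 : Fin 3) 2))).toMulEquiv (Subgroup.centralizer ({(⟨circleDiagonal 3 (z₁ w), circleDiagonal_mem_archLocal_diagonal L 3 ((α ∘ ⇑τ) ∘ ⇑(Equiv.swap (0 : Fin 3) 2)) w (z₁ w)⟩ : archLocal L 3 (Matrix.diagonal ((α ∘ ⇑τ) ∘ ⇑(Equiv.swap (0 : Fin 3) 2))) w)} : Set (archLocal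 L 3 (Matrix.diagonal ((α ∘ ⇑τ) ∘ ⇑(Equiv.swap (0 : Fin 3) 2))) w))) (Subgroup.centralizer ({(⟨circleDiagonal 3 (z₁ w), circleDiagonal_mem_archLocal_diagonal L 3 (α ∘ ⇑τ) w (z₁ w)⟩ : archLocal L 3 (Matrix.diagonal (α ∘ ⇑τ)) w)} : Set (archLocal L 3 (Matrix.diagonal (α ∘ ⇑τ)) w))) (forall_apply_mem_centralizer_singleton_iff_of_eq (ContinuousMulEquiv.restrictSubgroup (GLn.conjEquiv (Matrix.GeneralLinearGroup.mkOfDetNeZero _ (det_monomial_one_ne_zero 3 (Equiv.swap (0 : Fin 3) 2)))) (archLocal L 3 (Matrix.diagonal ((α ∘ ⇑τ) ∘ ⇑(Equiv.swap (0 : Fin 3) 2))) w) (archLocal L 3 (Matrix.diagonal (α ∘ ⇑τ)) w) (mem_archLocal_comp_perm_iff_conj_mem L 3 (α ∘ ⇑τ) w (Equiv.swap (0 : Fin 3) 2))).toMulEquiv ((relabel_circleDiagonal L 3 (α ∘ ⇑τ) w (Equiv.swap (0 : Fin 3) 2) (z₁ w)).trans (Subtype.ext (congrArg (circleDiagonal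 3) (comp_swap02_symm_eq_self_of_wall (z₁ w) (h02 w)))))) (ContinuousMulEquiv.restrictSubgroup (GLn.conjEquiv (Matrix.GeneralLinearGroup.mkOfDetNeZero _ (det_monomial_one_ne_zero 3 (Equiv.swap (0 : Fin 3) 2)))) (archLocal L 3 (Matrix.diagonal ((α ∘ ⇑τ) ∘ ⇑(Equiv.swap (0 : Fin 3) 2))) w) (archLocal L 3 (Matrix.diagonal (α ∘ ⇑τ)) w) (mem_archLocal_comp_perm_iff_conj_mem L 3 (α ∘ ⇑τ) w (Equiv.swap (0 : Fin 3) 2))).continuous (ContinuousMulEquiv.restrictSubgroup (GLn.conjEquiv (Matrix.GeneralLinearGroup.mkOfDetNeZero _ (det_monomial_one_ne_zero 3 (Equiv.swap (0 : Fin 3) 2)))) (archLocal L 3 (Matrix.diagonal ((α ∘ ⇑τ) ∘ ⇑(Equiv.swap (0 : Fin 3) 2))) w) (archLocal L 3 (Matrix.diagonal (α ∘ ⇑τ)) w) (mem_archLocal_comp_perm_iff_conj_mem L 3 (α ∘ ⇑τ) w (Equiv.swap (0 : Fin 3) 2))).symm.continuous)))) ∧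
      (∀ (w : {w : InfinitePlace L // IsComplex w}), (∀ (τ : Perm (Fin 3)), (w.1.embedding (α (τ 0))).re * (w.1.embedding (α (τ 2))).re < 0 →
      ∀ (h01s : 0 < (w.1.embedding ((α ∘ ⇑τ) 0)).re * (w.1.embedding ((α ∘ ⇑τ) 1)).re),
      νH w (τ * Equiv.swap (0 : Fin 3) 1) = ((νH w τ).map (subgroupCongrHomeomorph (ContinuousMulEquiv.restrictSubgroup (GLn.conjEquiv (Matrix.GeneralLinearGroup.mkOfDetNeZero (Matrix.diagonal ![((Real.sqrt ((w.1.embedding ((α ∘ ⇑τ) 0)).re / (w.1.embedding ((α ∘ ⇑τ) 1)).re) : ℝ) : ℂ), ((Real.sqrt ((w.1.embedding ((α ∘ ⇑τ) 1)).re / (w.1.embedding ((α ∘ ⇑τ) 0)).re) : ℝ) : ℂ), 1]) (det_rescale01_ne_zero h01s))) (archLocal L 3 (Matrix.diagonal (α ∘ ⇑τ)) w) (archLocal L 3 (Matrix.diagonal ((α ∘ ⇑τ) ∘ ⇑(Equiv.swap (0 : Fin 3) 1))) w) (mem_archLocal_diagonal_iff_conjEquiv_mem_of_formCongr_eq L 3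 (α ∘ ⇑τ) ((α ∘ ⇑τ) ∘ ⇑(Equiv.swap (0 : Fin 3) 1)) w (Matrix.GeneralLinearGroup.mkOfDetNeZero (Matrix.diagonal ![((Real.sqrt ((w.1.embedding ((α ∘ ⇑τ) 0)).re / (w.1.embedding ((α ∘ ⇑τ) 1)).re) : ℝ) : ℂ), ((Real.sqrt ((w.1.embedding ((α ∘ ⇑τ) 1)).re / (w.1.embedding ((α ∘ ⇑τ) 0)).re) : ℝ) : ℂ), 1]) (det_rescale01_ne_zero h01s)) (formCongr_rescale01_map_diagonal L (α ∘ ⇑τ) w (fun i => hreal w (τ i)) h01s))).toMulEquiv (Subgroup.centralizer ({(⟨circleDiagonal 3 (z₁ w), circleDiagonal_mem_archLocal_diagonal L 3 (α ∘ ⇑τ) w (z₁ w)⟩ : archLocal L 3 (Matrix.diagonal (α ∘ ⇑τ)) w)} : Set (archLocal L 3 (Matrix.diagonal (α ∘ ⇑τ)) w))) (Subgroup.centralizer ({(⟨circleDiagonal 3 (z₁ w), circleDiagonal_mem_archLocal_diagonal L 3 ((α ∘ ⇑τ) ∘ ⇑(Equiv.swap (0 : Fin 3) 1)) w (z₁ w)⟩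 : archLocal L 3 (Matrix.diagonal ((α ∘ ⇑τ) ∘ ⇑(Equiv.swap (0 : Fin 3) 1))) w)} : Set (archLocal L 3 (Matrix.diagonal ((α ∘ ⇑τ) ∘ ⇑(Equiv.swap (0 : Fin 3) 1))) w))) (forall_apply_mem_centralizer_singleton_iff_of_eq (ContinuousMulEquiv.restrictSubgroup (GLn.conjEquiv (Matrix.GeneralLinearGroup.mkOfDetNeZero (Matrix.diagonal ![((Real.sqrt ((w.1.embedding ((α ∘ ⇑τ) 0)).re / (w.1.embedding ((α ∘ ⇑τ) 1)).re) : ℝ) : ℂ), ((Real.sqrt ((w.1.embedding ((α ∘ ⇑τ) 1)).re / (w.1.embedding ((α ∘ ⇑τ) 0)).re) : ℝ) : ℂ), 1]) (det_rescale01_ne_zero h01s))) (archLocal L 3 (Matrix.diagonal (α ∘ ⇑τ)) w) (archLocal L 3 (Matrix.diagonal ((α ∘ ⇑τ) ∘ ⇑(Equiv.swap (0 : Fin 3) 1))) w) (mem_archLocal_diagonal_iff_conjEquiv_mem_of_formCongr_eq L 3 (α ∘ ⇑τ) ((α ∘ ⇑τ) ∘ ⇑(Equiv.swap (0 : Fin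 3) 1)) w (Matrix.GeneralLinearGroup.mkOfDetNeZero (Matrix.diagonal ![((Real.sqrt ((w.1.embedding ((α ∘ ⇑τ) 0)).re / (w.1.embedding ((α ∘ ⇑τ) 1)).re) : ℝ) : ℂ), ((Real.sqrt ((w.1.embedding ((α ∘ ⇑τ) 1)).re / (w.1.embedding ((α ∘ ⇑τ) 0)).re) : ℝ) : ℂ), 1]) (det_rescale01_ne_zero h01s)) (formCongr_rescale01_map_diagonal L (α ∘ ⇑τ) w (fun i => hreal w (τ i)) h01s))).toMulEquiv (congrT_circleDiagonal L 3 (α ∘ ⇑τ) ((α ∘ ⇑τ) ∘ ⇑(Equiv.swap (0 : Fin 3) 1)) w (Matrix.GeneralLinearGroup.mkOfDetNeZero (Matrix.diagonal ![((Real.sqrt ((w.1.embedding ((α ∘ ⇑τ) 0)).re / (w.1.embedding ((α ∘ ⇑τ) 1)).re) : ℝ) : ℂ), ((Real.sqrt ((w.1.embedding ((α ∘ ⇑τ) 1)).re / (w.1.embedding ((α ∘ ⇑τ) 0)).re) : ℝ) : ℂ), 1]) (det_rescale01_ne_zero h01s)) (formCongr_rescale01_map_diagonal L (α ∘ ⇑τ)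 w (fun i => hreal w (τ i)) h01s) (rescale01_conj_circleDiagonal L (α ∘ ⇑τ) w h01s) (z₁ w))) (ContinuousMulEquiv.restrictSubgroup (GLn.conjEquiv (Matrix.GeneralLinearGroup.mkOfDetNeZero (Matrix.diagonal ![((Real.sqrt ((w.1.embedding ((α ∘ ⇑τ) 0)).re / (w.1.embedding ((α ∘ ⇑τ) 1)).re) : ℝ) : ℂ), ((Real.sqrt ((w.1.embedding ((α ∘ ⇑τ) 1)).re / (w.1.embedding ((α ∘ ⇑τ) 0)).re) : ℝ) : ℂ), 1]) (det_rescale01_ne_zero h01s))) (archLocal L 3 (Matrix.diagonal (α ∘ ⇑τ)) w) (archLocal L 3 (Matrix.diagonal ((α ∘ ⇑τ) ∘ ⇑(Equiv.swap (0 : Fin 3) 1))) w) (mem_archLocal_diagonal_iff_conjEquiv_mem_of_formCongr_eq L 3 (α ∘ ⇑τ) ((α ∘ ⇑τ) ∘ ⇑(Equiv.swap (0 : Fin 3) 1)) w (Matrix.GeneralLinearGroup.mkOfDetNeZero (Matrix.diagonal ![((Real.sqrt ((w.1.embedding ((α ∘ ⇑τ) 0)).re / (w.1.embedding ((α ∘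 ⇑τ) 1)).re) : ℝ) : ℂ), ((Real.sqrt ((w.1.embedding ((α ∘ ⇑τ) 1)).re / (w.1.embedding ((α ∘ ⇑τ) 0)).re) : ℝ) : ℂ), 1]) (det_rescale01_ne_zero h01s)) (formCongr_rescale01_map_diagonal L (α ∘ ⇑τ) w (fun i => hreal w (τ i)) h01s))).continuous (ContinuousMulEquiv.restrictSubgroup (GLn.conjEquiv (Matrix.GeneralLinearGroup.mkOfDetNeZero (Matrix.diagonal ![((Real.sqrt ((w.1.embedding ((α ∘ ⇑τ) 0)).re / (w.1.embedding ((α ∘ ⇑τ) 1)).re) : ℝ) : ℂ), ((Real.sqrt ((w.1.embedding ((α ∘ ⇑τ) 1)).re / (w.1.embedding ((α ∘ ⇑τ) 0)).re) : ℝ) : ℂ), 1]) (det_rescale01_ne_zero h01s))) (archLocal L 3 (Matrix.diagonal (α ∘ ⇑τ)) w) (archLocal L 3 (Matrix.diagonal ((α ∘ ⇑τ) ∘ ⇑(Equiv.swap (0 : Fin 3) 1))) w) (mem_archLocal_diagonal_iff_conjEquiv_mem_of_formCongr_eq L 3 (α ∘ ⇑τ) ((α ∘ ⇑τ) ∘ ⇑(Equiv.swap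 (0 : Fin 3) 1)) w (Matrix.GeneralLinearGroup.mkOfDetNeZero (Matrix.diagonal ![((Real.sqrt ((w.1.embedding ((α ∘ ⇑τ) 0)).re / (w.1.embedding ((α ∘ ⇑τ) 1)).re) : ℝ) : ℂ), ((Real.sqrt ((w.1.embedding ((α ∘ ⇑τ) 1)).re / (w.1.embedding ((α ∘ ⇑τ) 0)).re) : ℝ) : ℂ), 1]) (det_rescale01_ne_zero h01s)) (formCongr_rescale01_map_diagonal L (α ∘ ⇑τ) w (fun i => hreal w (τ i)) h01s))).symm.continuous)))) := by
  classical
  -- one existence statement per `(w, τ)`: base measure everywhere, the `(−1)`-pin at the noncompact relabellings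
  have hall : ∀ (w : {w : InfinitePlace L // IsComplex w}) (τ : Perm (Fin 3)), ∃ (νH : Measure (Subgroup.centralizer ({(⟨circleDiagonal 3 (z₁ w), circleDiagonal_mem_archLocal_diagonal L 3 (α ∘ ⇑τ) w (z₁ w)⟩ : archLocal L 3 (Matrix.diagonal (α ∘ ⇑τ)) w)} : Set (archLocal L 3 (Matrix.diagonal (α ∘ ⇑τ)) w)))) (h1 : νH.IsHaarMeasure) (h2 : νH.IsInvInvariant),
      (w.1.embedding (α (τ 0))).re * (w.1.embedding (α (τ 2))).re < 0 →
      haveI : LocallyCompactSpace (archLocal L 3 (Matrix.diagonal (α ∘ ⇑τ)) w) := locallyCompactSpace_archLocal L 3 (Matrix.diagonal (α ∘ ⇑τ)) w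
      haveI : SecondCountableTopology (archLocal L 3 (Matrix.diagonal (α ∘ ⇑τ)) w) := secondCountableTopology_archLocal L 3 (Matrix.diagonal (α ∘ ⇑τ)) w
      haveI : νH.IsHaarMeasure := h1
      haveI : νH.IsInvInvariant := h2
      haveI : (νw w).IsHaarMeasure := (hνw w).1
      haveI : (νw w).IsMulRightInvariant := (hνw w).2
      haveI : ((νw w).map (ContinuousMulEquiv.restrictSubgroup (GLn.conjEquiv (Matrix.GeneralLinearGroup.mkOfDetNeZero _ (det_monomial_one_ne_zero 3 τ))) (archLocal L 3 (Matrix.diagonal (α ∘ ⇑τ)) w) (archLocal L 3 (Matrix.diagonal α) w) (mem_archLocal_comp_perm_iff_conj_mem L 3 α w τ)).symm).IsHaarMeasure := ContinuousMulEquiv.isHaarMeasure_map (νw w) _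
      haveI : (νw w).IsHaarMeasure := (hνw w).1
      haveI : (νw w).IsMulRightInvariant := (hνw w).2
      haveI : ((νw w).map (ContinuousMulEquiv.restrictSubgroup (GLn.conjEquiv (Matrix.GeneralLinearGroup.mkOfDetNeZero _ (det_monomial_one_ne_zero 3 τ))) (archLocal L 3 (Matrix.diagonal (α ∘ ⇑τ)) w) (archLocal L 3 (Matrix.diagonal α) w) (mem_archLocal_comp_perm_iff_conj_mem L 3 α w τ)).symm).IsMulRightInvariant := isMulRightInvariant_map_relabel_symm L 3 α w τ (νw w)
      ∀ (Θ : Matrix (Fin 3) (Fin 3) ℂ → ℂ), ContDiff ℝ (⊤ : ℕ∞) Θ →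
        HasCompactSupport (fun k : archLocal L 3 (Matrix.diagonal (α ∘ ⇑τ)) w => Θ ((k : GL (Fin 3) ℂ) : Matrix (Fin 3) (Fin 3) ℂ)) →
        ∀ (z₀ : Fin 3 → Circle) (h02' : z₀ 0 = z₀ 2) (h01' : z₀ 0 ≠ z₀ 1),
          Tendsto (fun ψ : ℝ => deriv (fun ψ : ℝ => (2 * Real.sin ψ : ℂ) *
              ∫ g, Θ (((g * ⟨circleDiagonal 3 (fun i => z₀ i * Circle.exp (![(1 : ℝ), 0, -1] i * ψ)),
                circleDiagonal_mem_archLocal_diagonal L 3 (α ∘ ⇑τ) w _⟩ * g⁻¹ : archLocal L 3 (Matrix.diagonal (α ∘ ⇑τ)) w) : GL (Fin 3) ℂ) : Matrix (Fin 3) (Fin 3) ℂ) ∂((νw w).map (ContinuousMulEquiv.restrictSubgroup (GLn.conjEquiv (Matrix.GeneralLinearGroup.mkOfDetNeZero _ (det_monomial_one_ne_zero 3 τ))) (archLocal L 3 (Matrix.diagonal (α ∘ ⇑τ)) w) (archLocal L 3 (Matrix.diagonal α) w) (mem_archLocal_comp_perm_iff_conj_mem L 3 α w τ)).symm)) ψ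)
            (𝓝[≠] 0)
            (𝓝 ((-1 : ℂ) * ∫ y, descConj (⟨circleDiagonal 3 z₀, circleDiagonal_mem_archLocal_diagonal L 3 (α ∘ ⇑τ) w z₀⟩ : archLocal L 3 (Matrix.diagonal (α ∘ ⇑τ)) w)
              (Subgroup.centralizer ({(⟨circleDiagonal 3 (z₁ w), circleDiagonal_mem_archLocal_diagonal L 3 (α ∘ ⇑τ) w (z₁ w)⟩ : archLocal L 3 (Matrix.diagonal (α ∘ ⇑τ)) w)} : Set (archLocal L 3 (Matrix.diagonal (α ∘ ⇑τ)) w)))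
              (forall_mem_centralizer_circleDiagonal_comm_of_wall L (α ∘ ⇑τ) w (h02 w) (h01 w) h02' h01')
              (fun k : archLocal L 3 (Matrix.diagonal (α ∘ ⇑τ)) w => Θ ((k : GL (Fin 3) ℂ) : Matrix (Fin 3) (Fin 3) ℂ)) y
              ∂(quotientMeasure _ νH (isClosed_coe_centralizer_singleton _) ((νw w).map (ContinuousMulEquiv.restrictSubgroup (GLn.conjEquiv (Matrix.GeneralLinearGroup.mkOfDetNeZero _ (det_monomial_one_ne_zero 3 τ))) (archLocal L 3 (Matrix.diagonal (α ∘ ⇑τ)) w) (archLocal L 3 (Matrix.diagonal α) w) (mem_archLocal_comp_perm_iff_conj_mem L 3 α w τ)).symm)))) := by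
    intro w τ
    haveI : LocallyCompactSpace (archLocal L 3 (Matrix.diagonal (α ∘ ⇑τ)) w) := locallyCompactSpace_archLocal L 3 (Matrix.diagonal (α ∘ ⇑τ)) w
    haveI : SecondCountableTopology (archLocal L 3 (Matrix.diagonal (α ∘ ⇑τ)) w) := secondCountableTopology_archLocal L 3 (Matrix.diagonal (α ∘ ⇑τ)) w
    haveI : (νw w).IsHaarMeasure := (hνw w).1
    haveI : (νw w).IsMulRightInvariant := (hνw w).2
    obtain ⟨νH₀, h₀, -, h₀i⟩ := exists_isHaarMeasure_isInvInvariant_centralizer_circleDiagonal_wall L (α ∘ ⇑τ) w (fun i => hα (τ i)) (fun i => hreal w (τ i)) (h02 w) (h01 w)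
    haveI := h₀
    haveI := h₀i
    by_cases hτ : (w.1.embedding (α (τ 0))).re * (w.1.embedding (α (τ 2))).re < 0
    · haveI : ((νw w).map (ContinuousMulEquiv.restrictSubgroup (GLn.conjEquiv (Matrix.GeneralLinearGroup.mkOfDetNeZero _ (det_monomial_one_ne_zero 3 τ))) (archLocal L 3 (Matrix.diagonal (α ∘ ⇑τ)) w) (archLocal L 3 (Matrix.diagonal α) w) (mem_archLocal_comp_perm_iff_conj_mem L 3 α w τ)).symm).IsHaarMeasure := ContinuousMulEquiv.isHaarMeasure_map (νw w) _
      haveI : (νw w).IsHaarMeasure := (hνw w).1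
      haveI : (νw w).IsMulRightInvariant := (hνw w).2
      haveI : ((νw w).map (ContinuousMulEquiv.restrictSubgroup (GLn.conjEquiv (Matrix.GeneralLinearGroup.mkOfDetNeZero _ (det_monomial_one_ne_zero 3 τ))) (archLocal L 3 (Matrix.diagonal (α ∘ ⇑τ)) w) (archLocal L 3 (Matrix.diagonal α) w) (mem_archLocal_comp_perm_iff_conj_mem L 3 α w τ)).symm).IsMulRightInvariant := isMulRightInvariant_map_relabel_symm L 3 α w τ (νw w)
      obtain ⟨νH, h1, h2, hcl⟩ := exists_centralizer_measure_clause_neg_one L (α ∘ ⇑τ) w (fun i => hα (τ i)) (fun i => hreal w (τ i)) hτ ((νw w).map (ContinuousMulEquiv.restrictSubgroup (GLn.conjEquiv (Matrix.GeneralLinearGroup.mkOfDetNeZero _ (det_monomial_one_ne_zero 3 τ))) (archLocal L 3 (Matrix.diagonal (α ∘ ⇑τ)) w) (archLocal L 3 (Matrix.diagonal α) w) (mem_archLocal_comp_perm_iff_conj_mem L 3 α w τ)).symm) (z₁ w) (h02 w) (h01 w) νH₀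
      exact ⟨νH, h1, h2, fun _ => hcl⟩
    · exact ⟨νH₀, h₀, h₀i, fun h => absurd h hτ⟩
  choose νH hH hI hcl using hall
  refine ⟨νH, fun w τ => ⟨hH w τ, hI w τ⟩, fun w τ hτ => hcl w τ hτ, fun w => ?_, fun w => ?_⟩
  · exact (centralizer_measure_links_of_clause_neg_one L α w hα (hreal w) (z₁ w) (h02 w) (h01 w) (νH w) (fun τ => ⟨hH w τ, hI w τ⟩)
      (fun τ => ((νw w).map (ContinuousMulEquiv.restrictSubgroup (GLn.conjEquiv (Matrix.GeneralLinearGroup.mkOfDetNeZero _ (det_monomial_one_ne_zero 3 τ))) (archLocal L 3 (Matrix.diagonal (α ∘ ⇑τ)) w) (archLocal L 3 (Matrix.diagonal α) w) (mem_archLocal_comp_perm_iff_conj_mem L 3 α w τ)).symm)) (fun τ => by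
        haveI := (hνw w).1; haveI := (hνw w).2
        exact ⟨ContinuousMulEquiv.isHaarMeasure_map (νw w) _, isMulRightInvariant_map_relabel_symm L 3 α w τ (νw w)⟩)
      (fun τ hτ => hcl w τ hτ)).1
  · exact (centralizer_measure_links_of_clause_neg_one L α w hα (hreal w) (z₁ w) (h02 w) (h01 w) (νH w) (fun τ => ⟨hH w τ, hI w τ⟩)
      (fun τ => ((νw w).map (ContinuousMulEquiv.restrictSubgroup (GLn.conjEquiv (Matrix.GeneralLinearGroup.mkOfDetNeZero _ (det_monomial_one_ne_zero 3 τ))) (archLocal L 3 (Matrix.diagonal (α ∘ ⇑τ)) w) (archLocal L 3 (Matrix.diagonal α) w) (mem_archLocal_comp_perm_iff_conj_mem L 3 α w τ)).symm)) (fun τ => by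
        haveI := (hνw w).1; haveI := (hνw w).2
        exact ⟨ContinuousMulEquiv.isHaarMeasure_map (νw w) _, isMulRightInvariant_map_relabel_symm L 3 α w τ (νw w)⟩)
      (fun τ hτ => hcl w τ hτ)).2

end RefFamily

end Literature.NumberTheory.Rogawski1990

end
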